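import Summits.QuantumFields.YangMills.Theorems.IsotropyFromPowerCountingTemperedCurvatureMomentsDegreeTwo

/-!
# Degree three of `TemperedCurvatureMoments` from a three-point kernel — stub `stub_degreeThreeOfKernel`

Line `Sketch` (markov-shielding) of crux `IsotropyFromPowerCounting.TemperedCurvatureMoments`
(T, stmt-QuantumFields-17721), stub `stub_degreeThreeOfKernel` (F) of reshape 4 of the registered
skeleton `Cruxes/TemperedCurvatureMoments/Lines/Sketch.lean` (registered signature verbatim).

Statement.  Let `S₁` be a one-species Schwinger family on `ℝ⁴` whose three-point function is, on
compactly supported test functions supported in the injective locus `{y | y injective}` of `(ℝ⁴)³`,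
integration against a kernel `K₃` continuous on the injective locus and dominated there by T's
tempered pair weight `w_{C,N}(y) = C (1 + ‖y‖)^N (1 + Σᵢ Σ_{j ≠ i} ‖yᵢ - yⱼ‖⁻¹)^N` (`C > 0`), and
whose three-point values on real off-diagonal tensors are real.  Then for every admissible pair
`(a, L)` (`a_k > 0`, `a_k → 0`, `a_k L_k → ∞`): `TemperedApproximants a L S₁ 3`.

Proof (pure analysis over landed lemmas; everything below is stated for general `n`).
1. *The integrand on `⁰𝒮`* (`DegreeThreeOfKernel.integrable_kernel_mul`): for `H ∈ ⁰𝒮ₙ`,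
   `‖K y H y‖ ≤ ‖H y‖ w(y)` everywhere (weight bound at injective `y`, `H y = 0` at coincident `y`,
   `IsOffDiagonal.apply_eq_zero`); `K H` is a.e. strongly measurable because `K H` is continuous on
   the open injective locus, whose complement, the coincidence locus, is Lebesgue-null
   (`DominatedTieLimit.volume_coincidenceLocus`); and `‖H‖ w ∈ L¹`
   (`DegreeTwoModelBlind.integrable_norm_mul_pairWeight`).  Moreover
   `∫ ‖H‖ w ≤ K₀ · sup_{≤ (N+4n+1, N+1)} ‖H‖` with `K₀ = |C| 4^{N+4n+1} (1+n²)^N ∫ (1+‖y‖)^{-(4n+1)}`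
   (`DominatedTieLimit.norm_mul_weight_le`, `DominatedTieLimit.integrable_piMajorant`), so
   `H ↦ ∫ K H` is continuous on `⁰𝒮ₙ` for the Schwartz topology
   (`DegreeThreeOfKernel.rep_of_tendsto`: a representation `T Φₘ = ∫ K Φₘ` passes to Schwartz
   limits `Φₘ → F` inside `⁰𝒮ₙ`).
2. *From compact support to support in the injective locus* (`rep_of_tsupport_subset`): the bump
   cut-offs at infinity `uₘ → G` of `exists_tsupport_subset_inter_closedBall_tendsto` are compactly
   supported inside `tsupport G`.
3. *From support in the injective locus to `⁰𝒮ₙ`* (`rep_of_isOffDiagonal`): the diagonal cut-offs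
   `ψ_k F → F` of crux 11686 (`offDiagCutoffFamily`, `offDiagCutoffTendsto`) are supported off the
   coincidence locus (`tsupport_cutoff_mul_subset_compl_coincidenceLocus`).
4. *Domination* (`dominated_of_kernel`): `‖S₁ n F‖ = ‖∫ K F‖ ≤ ∫ ‖K F‖ ≤ ∫ ‖F‖ w` on `⁰𝒮ₙ`; then
   the landed `temperedApproximants_of_dominated` (p164918) with `n = 3`.

References: K. Osterwalder, R. Schrader, Comm. Math. Phys. 31 (1973) §2 and 42 (1975) §2 (`⁰𝒮`);
L. Hörmander, ALPDO I, Lemma 7.1.8 (density of `C_c^∞` off a closed set in the flat functions);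
J. Glimm, A. Jaffe, Quantum Physics (1987) §6.1 (lattice approximation). [folklore]
-/

noncomputable section


namespace Summit.QuantumFields.YangMills.Theorems.TemperedCurvatureMoments.Sketch

open scoped BigOperators SchwartzMap
open MeasureTheory Filter Topology Set
open Literature.MathematicalPhysics.QuantumFieldTheory Literature.MathematicalPhysics.QuantumLattice
open Literature.MathematicalPhysics.AQFT
open Summit.QuantumFields.YangMills.Theorems.NPointIsotropy.Negative (E4)
open Summit.QuantumFields.YangMills.Theorems.CurvatureBoostCovariance.Negative
  (OSPackage Translations Hypercubic EightFrameRP PlanarCone)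
open Summit.QuantumFields.YangMills.Theorems.TemperedCurvatureMoments.Negative (TemperedApproximants)
open Summit.QuantumFields.YangMills.Theorems.CurvatureBoostCovariance.BoostsInheritMirrors
  (DominatedTieLimit.norm_mul_weight_le DominatedTieLimit.integrable_piMajorant
    DominatedTieLimit.volume_coincidenceLocus)
open Summit.QuantumFields.YangMills.Theorems.NPointIsotropy.ComplexRotationBandlimit
  (offDiagCutoffFamily offDiagCutoffTendsto tsupport_cutoff_mul_subset_compl_coincidenceLocus)

namespace DegreeThreeOfKernel

variable {n : ℕ}

/-! ## The injective locus -/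

/-- The injective configurations of `(ℝ⁴)ⁿ` are exactly the complement of the coincidence locus.
[folklore] -/
theorem setOf_injective_eq_compl :
    {y : Fin n → E4 | Function.Injective y} = (coincidenceLocus n E4)ᶜ := by
  ext y
  simp only [mem_setOf_eq, mem_compl_iff, mem_coincidenceLocus, not_exists, not_and]
  exact ⟨fun h i j hij hEq => hij (h hEq), fun h i j hEq => by_contra fun hij => h i j hij hEq⟩

/-- A non-injective configuration lies on the coincidence locus. [folklore] -/
theorem mem_coincidenceLocus_of_not_injective {y : Fin n → E4} (hy : ¬ Function.Injective y) :
    y ∈ coincidenceLocus n E4 := by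
  by_contra h
  rw [← mem_compl_iff, ← setOf_injective_eq_compl] at h
  exact hy h

/-! ## The integrand `K y * H y` for `H ∈ ⁰𝒮ₙ` -/

/-- **Pointwise domination.**  If `‖K y‖ ≤ w_{C,N}(y)` at injective `y`, then for `H ∈ ⁰𝒮ₙ` and
every `y`: `‖K y * H y‖ ≤ ‖H y‖ w_{C,N}(y)` (at non-injective `y` the test function vanishes,
`IsOffDiagonal.apply_eq_zero`). [folklore] -/
theorem norm_kernel_mul_le (K : (Fin n → E4) → ℂ) {C : ℝ} {N : ℕ}
    (hK : ∀ y : Fin n → E4, Function.Injective y →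
      ‖K y‖ ≤ C * (1 + ‖y‖) ^ N * (1 + ∑ i, ∑ j ∈ Finset.univ.erase i, ‖y i - y j‖⁻¹) ^ N)
    {H : 𝓢((Fin n → E4), ℂ)} (hH : IsOffDiagonal H) (y : Fin n → E4) :
    ‖K y * H y‖ ≤ ‖H y‖ * (C * (1 + ‖y‖) ^ N *
      (1 + ∑ i, ∑ j ∈ Finset.univ.erase i, ‖y i - y j‖⁻¹) ^ N) := by
  by_cases hy : Function.Injective y
  · rw [norm_mul, mul_comm]
    exact mul_le_mul_of_nonneg_left (hK y hy) (norm_nonneg _)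
  · rw [hH.apply_eq_zero (mem_coincidenceLocus_of_not_injective hy), mul_zero, norm_zero,
      zero_mul]

/-- **Measurability.**  For `K` continuous on the injective locus (open, with Lebesgue-null
complement `DominatedTieLimit.volume_coincidenceLocus`) and any Schwartz `H`, the integrand
`y ↦ K y * H y` is a.e. strongly measurable (`ContinuousOn.aestronglyMeasurable` on the locus, and
the restriction to a co-null set is the whole measure). [folklore] -/
theorem aestronglyMeasurable_kernel_mul (K : (Fin n → E4) → ℂ)
    (hKc : ContinuousOn K {y | Function.Injective y}) (H : 𝓢((Fin n → E4), ℂ)) :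
    AEStronglyMeasurable (fun y => K y * H y) volume := by
  have hU : IsOpen {y : Fin n → E4 | Function.Injective y} := by
    rw [setOf_injective_eq_compl]
    exact (isClosed_coincidenceLocus n E4).isOpen_compl
  have hae : ∀ᵐ y ∂(volume : Measure (Fin n → E4)),
      y ∈ {y : Fin n → E4 | Function.Injective y} := by
    rw [setOf_injective_eq_compl]
    exact measure_eq_zero_iff_ae_notMem.1 (DominatedTieLimit.volume_coincidenceLocus n)
  have h := (hKc.mul H.continuous.continuousOn).aestronglyMeasurable
    (μ := (volume : Measure (Fin n → E4))) hU.measurableSet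
  rwa [Measure.restrict_eq_self_of_ae_mem hae] at h

/-- **Integrability.**  With `C > 0`, `K` continuous on the injective locus and `‖K‖ ≤ w_{C,N}`
there, `K H ∈ L¹` for every `H ∈ ⁰𝒮ₙ`: it is measurable and dominated by `‖H‖ w_{C,N} ∈ L¹`
(`DegreeTwoModelBlind.integrable_norm_mul_pairWeight`). [folklore] -/
theorem integrable_kernel_mul (K : (Fin n → E4) → ℂ) {C : ℝ} {N : ℕ} (hC : 0 < C)
    (hKc : ContinuousOn K {y | Function.Injective y})
    (hK : ∀ y : Fin n → E4, Function.Injective y →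
      ‖K y‖ ≤ C * (1 + ‖y‖) ^ N * (1 + ∑ i, ∑ j ∈ Finset.univ.erase i, ‖y i - y j‖⁻¹) ^ N)
    {H : 𝓢((Fin n → E4), ℂ)} (hH : IsOffDiagonal H) :
    Integrable (fun y => K y * H y) :=
  (DegreeTwoModelBlind.integrable_norm_mul_pairWeight hC N hH).mono'
    (aestronglyMeasurable_kernel_mul K hKc H) (ae_of_all _ fun y => norm_kernel_mul_le K hK hH y)

/-! ## `H ↦ ∫ ‖H‖ w` is controlled by finitely many Schwartz seminorms on `⁰𝒮ₙ` -/

/-- **`∫ ‖H‖ w_{C,N}` against Schwartz seminorms.**  For `H ∈ ⁰𝒮ₙ` and `C > 0`: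
`∫ ‖H‖ w_{C,N} ≤ K₀ · sup_{≤ (N+4n+1, N+1)} ‖H‖` with
`K₀ = ∫ |C| 4^{N+4n+1} (1 + n²)^N (1 + ‖y‖)^{-(4n+1)} dy` (pointwise majorant
`DominatedTieLimit.norm_mul_weight_le`, integrable by `DominatedTieLimit.integrable_piMajorant`).
[folklore] -/
theorem integral_norm_mul_weight_le {C : ℝ} (hC : 0 < C) (N : ℕ) {H : 𝓢((Fin n → E4), ℂ)}
    (hH : IsOffDiagonal H) :
    ∫ y : Fin n → E4, ‖H y‖ * (C * (1 + ‖y‖) ^ N *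
        (1 + ∑ i, ∑ j ∈ Finset.univ.erase i, ‖y i - y j‖⁻¹) ^ N) ≤
      (∫ y : Fin n → E4, |C| * 4 ^ (N + (4 * n + 1)) * (1 + (n : ℝ) ^ 2) ^ N *
          ((1 + ‖y‖) ^ (4 * n + 1))⁻¹) *
        (Finset.Iic (N + (4 * n + 1), N + 1)).sup (schwartzSeminormFamily ℂ (Fin n → E4) ℂ) H := by
  set S := (Finset.Iic (N + (4 * n + 1), N + 1)).sup (schwartzSeminormFamily ℂ (Fin n → E4) ℂ) H
    with hS
  have hmaj : ∀ y : Fin n → E4, ‖H y‖ * (C * (1 + ‖y‖) ^ N *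
      (1 + ∑ i, ∑ j ∈ Finset.univ.erase i, ‖y i - y j‖⁻¹) ^ N) ≤
      |C| * 4 ^ (N + (4 * n + 1)) * (1 + (n : ℝ) ^ 2) ^ N * S * ((1 + ‖y‖) ^ (4 * n + 1))⁻¹ :=
    fun y => DominatedTieLimit.norm_mul_weight_le hH
      (w := fun y : Fin n → E4 => C * (1 + ‖y‖) ^ N *
        (1 + ∑ i, ∑ j ∈ Finset.univ.erase i, ‖y i - y j‖⁻¹) ^ N)
      (fun y _ => le_rfl) (4 * n + 1) y
  have hint : Integrable (fun y : Fin n → E4 =>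
      |C| * 4 ^ (N + (4 * n + 1)) * (1 + (n : ℝ) ^ 2) ^ N * S * ((1 + ‖y‖) ^ (4 * n + 1))⁻¹) :=
    DominatedTieLimit.integrable_piMajorant (n := n) (p := 4 * n + 1) (by omega) _
  calc ∫ y : Fin n → E4, ‖H y‖ * (C * (1 + ‖y‖) ^ N *
        (1 + ∑ i, ∑ j ∈ Finset.univ.erase i, ‖y i - y j‖⁻¹) ^ N)
      ≤ ∫ y : Fin n → E4, |C| * 4 ^ (N + (4 * n + 1)) * (1 + (n : ℝ) ^ 2) ^ N * S *
          ((1 + ‖y‖) ^ (4 * n + 1))⁻¹ :=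
        integral_mono (DegreeTwoModelBlind.integrable_norm_mul_pairWeight hC N hH) hint hmaj
    _ = ∫ y : Fin n → E4, |C| * 4 ^ (N + (4 * n + 1)) * (1 + (n : ℝ) ^ 2) ^ N *
          ((1 + ‖y‖) ^ (4 * n + 1))⁻¹ * S := integral_congr_ae (ae_of_all _ fun y => by ring)
    _ = (∫ y : Fin n → E4, |C| * 4 ^ (N + (4 * n + 1)) * (1 + (n : ℝ) ^ 2) ^ N *
          ((1 + ‖y‖) ^ (4 * n + 1))⁻¹) * S := integral_mul_const _ _

/-- **Finite sups of Schwartz seminorms tend to zero along convergent sequences.**  If `Φₘ → F` in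
`𝓢` then `sup_{s} ‖Φₘ - F‖ → 0` for every finite set `s` of seminorm indices
(`WithSeminorms.tendsto_nhds'`). [folklore] -/
theorem tendsto_sup_seminorm_sub {Φ : ℕ → 𝓢((Fin n → E4), ℂ)} {F : 𝓢((Fin n → E4), ℂ)}
    (hlim : Tendsto Φ atTop (𝓝 F)) (s : Finset (ℕ × ℕ)) :
    Tendsto (fun m => s.sup (schwartzSeminormFamily ℂ (Fin n → E4) ℂ) (Φ m - F)) atTop (𝓝 0) := by
  have h := ((schwartz_withSeminorms ℂ (Fin n → E4) ℂ).tendsto_nhds' Φ F).1 hlim s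
  refine Metric.tendsto_nhds.2 fun ε hε => (h ε hε).mono fun m hm => ?_
  rwa [Real.dist_eq, sub_zero, abs_of_nonneg (apply_nonneg _ _)]

/-! ## Kernel representations pass to Schwartz limits inside `⁰𝒮ₙ` -/

/-- **Limit lemma.**  Let `T` be a continuous functional on `𝓢((ℝ⁴)ⁿ, ℂ)`, `K` continuous on the
injective locus with `‖K‖ ≤ w_{C,N}` there (`C > 0`), and `Φₘ → F` in `𝓢` with all `Φₘ` and `F`
in `⁰𝒮ₙ`.  If `T Φₘ = ∫ K Φₘ` for all `m`, then `T F = ∫ K F`: `T Φₘ → T F` by continuity, and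
`|∫ K Φₘ - ∫ K F| ≤ ∫ ‖Φₘ - F‖ w_{C,N} ≤ K₀ sup ‖Φₘ - F‖ → 0` (`integral_norm_mul_weight_le`,
`tendsto_sup_seminorm_sub`). [folklore] -/
theorem rep_of_tendsto (T : 𝓢((Fin n → E4), ℂ) →L[ℂ] ℂ) (K : (Fin n → E4) → ℂ) {C : ℝ} {N : ℕ}
    (hC : 0 < C) (hKc : ContinuousOn K {y | Function.Injective y})
    (hK : ∀ y : Fin n → E4, Function.Injective y →
      ‖K y‖ ≤ C * (1 + ‖y‖) ^ N * (1 + ∑ i, ∑ j ∈ Finset.univ.erase i, ‖y i - y j‖⁻¹) ^ N)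
    {Φ : ℕ → 𝓢((Fin n → E4), ℂ)} {F : 𝓢((Fin n → E4), ℂ)} (hΦ : ∀ m, IsOffDiagonal (Φ m))
    (hF : IsOffDiagonal F) (hlim : Tendsto Φ atTop (𝓝 F))
    (hrep : ∀ m, T (Φ m) = ∫ y, K y * Φ m y) : T F = ∫ y, K y * F y := by
  set K₀ : ℝ := ∫ y : Fin n → E4, |C| * 4 ^ (N + (4 * n + 1)) * (1 + (n : ℝ) ^ 2) ^ N *
    ((1 + ‖y‖) ^ (4 * n + 1))⁻¹ with hK₀
  set s : Finset (ℕ × ℕ) := Finset.Iic (N + (4 * n + 1), N + 1) with hs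
  have hT : Tendsto (fun m => T (Φ m)) atTop (𝓝 (T F)) := (T.continuous.tendsto F).comp hlim
  have hD : ∀ m, IsOffDiagonal (Φ m - F) := fun m => by
    have h := (hΦ m).add (hF.smul (-1))
    rwa [neg_one_smul, ← sub_eq_add_neg] at h
  have hI : Tendsto (fun m => ∫ y, K y * Φ m y) atTop (𝓝 (∫ y, K y * F y)) := by
    rw [tendsto_iff_norm_sub_tendsto_zero]
    have h0 : Tendsto (fun m => K₀ * s.sup (schwartzSeminormFamily ℂ (Fin n → E4) ℂ) (Φ m - F))
        atTop (𝓝 0) := by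
      simpa using (tendsto_sup_seminorm_sub hlim s).const_mul K₀
    refine squeeze_zero (fun m => norm_nonneg _) (fun m => ?_) h0
    rw [← integral_sub (integrable_kernel_mul K hC hKc hK (hΦ m))
      (integrable_kernel_mul K hC hKc hK hF)]
    calc ‖∫ y, (K y * Φ m y - K y * F y)‖ ≤ ∫ y, ‖K y * Φ m y - K y * F y‖ :=
          norm_integral_le_integral_norm _
      _ ≤ ∫ y, ‖(Φ m - F) y‖ * (C * (1 + ‖y‖) ^ N *
            (1 + ∑ i, ∑ j ∈ Finset.univ.erase i, ‖y i - y j‖⁻¹) ^ N) := by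
          refine integral_mono ((integrable_kernel_mul K hC hKc hK (hΦ m)).sub
            (integrable_kernel_mul K hC hKc hK hF)).norm
            (DegreeTwoModelBlind.integrable_norm_mul_pairWeight hC N (hD m)) fun y => ?_
          show ‖K y * Φ m y - K y * F y‖ ≤ ‖(Φ m - F) y‖ * (C * (1 + ‖y‖) ^ N *
            (1 + ∑ i, ∑ j ∈ Finset.univ.erase i, ‖y i - y j‖⁻¹) ^ N)
          rw [← mul_sub]
          exact norm_kernel_mul_le K hK (hD m) y
      _ ≤ K₀ * s.sup (schwartzSeminormFamily ℂ (Fin n → E4) ℂ) (Φ m - F) :=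
          integral_norm_mul_weight_le hC N (hD m)
  exact tendsto_nhds_unique hT (hI.congr fun m => (hrep m).symm)

/-! ## From compactly supported test functions to `⁰𝒮ₙ` -/

/-- **Step 1: support in the injective locus.**  If `T F = ∫ K F` for every compactly supported
`F` with `tsupport F` inside the injective locus, then the same holds for every Schwartz `G` with
`tsupport G` inside the injective locus: the bump cut-offs at infinity `uₘ → G` of
`exists_tsupport_subset_inter_closedBall_tendsto` are compactly supported inside `tsupport G`, and
all of them lie in `⁰𝒮ₙ` (`IsOffDiagonal.of_tsupport_subset`); `rep_of_tendsto`. [folklore] -/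
theorem rep_of_tsupport_subset (T : 𝓢((Fin n → E4), ℂ) →L[ℂ] ℂ) (K : (Fin n → E4) → ℂ)
    {C : ℝ} {N : ℕ} (hC : 0 < C) (hKc : ContinuousOn K {y | Function.Injective y})
    (hK : ∀ y : Fin n → E4, Function.Injective y →
      ‖K y‖ ≤ C * (1 + ‖y‖) ^ N * (1 + ∑ i, ∑ j ∈ Finset.univ.erase i, ‖y i - y j‖⁻¹) ^ N)
    (hrep : ∀ F : 𝓢((Fin n → E4), ℂ), HasCompactSupport (F : (Fin n → E4) → ℂ) →
      tsupport (F : (Fin n → E4) → ℂ) ⊆ {y | Function.Injective y} →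
        Integrable (fun y => K y * F y) ∧ T F = ∫ y, K y * F y)
    (G : 𝓢((Fin n → E4), ℂ)) (hG : tsupport (G : (Fin n → E4) → ℂ) ⊆ {y | Function.Injective y}) :
    T G = ∫ y, K y * G y := by
  obtain ⟨u, hu, hlim⟩ := exists_tsupport_subset_inter_closedBall_tendsto G
  have hoff : ∀ H : 𝓢((Fin n → E4), ℂ),
      tsupport (H : (Fin n → E4) → ℂ) ⊆ {y | Function.Injective y} → IsOffDiagonal H :=
    fun H hH => IsOffDiagonal.of_tsupport_subset (by rwa [← setOf_injective_eq_compl])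
  have hus : ∀ m, tsupport (u m : (Fin n → E4) → ℂ) ⊆ {y | Function.Injective y} :=
    fun m => ((hu m).trans inter_subset_left).trans hG
  have huc : ∀ m, HasCompactSupport (u m : (Fin n → E4) → ℂ) := fun m =>
    IsCompact.of_isClosed_subset (isCompact_closedBall _ _) (isClosed_tsupport _)
      ((hu m).trans inter_subset_right)
  exact rep_of_tendsto T K hC hKc hK (fun m => hoff _ (hus m)) (hoff G hG) hlim
    fun m => (hrep (u m) (huc m) (hus m)).2

/-- **Step 2: all of `⁰𝒮ₙ`.**  Under the same hypotheses `T F = ∫ K F` for every `F ∈ ⁰𝒮ₙ`: the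
diagonal cut-offs `ψ_k F → F` in `𝓢` (`offDiagCutoffFamily`, `offDiagCutoffTendsto`, crux 11686)
are supported off the coincidence locus (`tsupport_cutoff_mul_subset_compl_coincidenceLocus`), so
Step 1 applies to each of them; `rep_of_tendsto`. [folklore] -/
theorem rep_of_isOffDiagonal (T : 𝓢((Fin n → E4), ℂ) →L[ℂ] ℂ) (K : (Fin n → E4) → ℂ)
    {C : ℝ} {N : ℕ} (hC : 0 < C) (hKc : ContinuousOn K {y | Function.Injective y})
    (hK : ∀ y : Fin n → E4, Function.Injective y →
      ‖K y‖ ≤ C * (1 + ‖y‖) ^ N * (1 + ∑ i, ∑ j ∈ Finset.univ.erase i, ‖y i - y j‖⁻¹) ^ N)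
    (hrep : ∀ F : 𝓢((Fin n → E4), ℂ), HasCompactSupport (F : (Fin n → E4) → ℂ) →
      tsupport (F : (Fin n → E4) → ℂ) ⊆ {y | Function.Injective y} →
        Integrable (fun y => K y * F y) ∧ T F = ∫ y, K y * F y)
    (F : 𝓢((Fin n → E4), ℂ)) (hF : IsOffDiagonal F) : T F = ∫ y, K y * F y := by
  obtain ⟨Cψ, ψ, hψs, hψ01, hψ1, hψ0, hψC⟩ := offDiagCutoffFamily n
  obtain ⟨u, hu, hlim⟩ := offDiagCutoffTendsto n Cψ ψ hψs hψ01 hψ1 hψC F hF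
  have hus : ∀ k, tsupport (u k : (Fin n → E4) → ℂ) ⊆ {y | Function.Injective y} := fun k => by
    rw [setOf_injective_eq_compl]
    exact tsupport_cutoff_mul_subset_compl_coincidenceLocus k (hψ0 k) (hu k)
  exact rep_of_tendsto T K hC hKc hK
    (fun k => IsOffDiagonal.of_tsupport_subset
      (tsupport_cutoff_mul_subset_compl_coincidenceLocus k (hψ0 k) (hu k))) hF hlim
    fun k => rep_of_tsupport_subset T K hC hKc hK hrep (u k) (hus k)

/-! ## Domination of the functional by T's pair weight -/

/-- **Domination on `⁰𝒮ₙ`.**  Under the same hypotheses, for every `F ∈ ⁰𝒮ₙ` the function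
`‖F‖ w_{C,N}` is integrable and `‖T F‖ ≤ ∫ ‖F‖ w_{C,N}`
(`‖T F‖ = ‖∫ K F‖ ≤ ∫ ‖K F‖ ≤ ∫ ‖F‖ w_{C,N}`). [folklore] -/
theorem dominated_of_kernel (T : 𝓢((Fin n → E4), ℂ) →L[ℂ] ℂ) (K : (Fin n → E4) → ℂ)
    {C : ℝ} {N : ℕ} (hC : 0 < C) (hKc : ContinuousOn K {y | Function.Injective y})
    (hK : ∀ y : Fin n → E4, Function.Injective y →
      ‖K y‖ ≤ C * (1 + ‖y‖) ^ N * (1 + ∑ i, ∑ j ∈ Finset.univ.erase i, ‖y i - y j‖⁻¹) ^ N)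
    (hrep : ∀ F : 𝓢((Fin n → E4), ℂ), HasCompactSupport (F : (Fin n → E4) → ℂ) →
      tsupport (F : (Fin n → E4) → ℂ) ⊆ {y | Function.Injective y} →
        Integrable (fun y => K y * F y) ∧ T F = ∫ y, K y * F y)
    (F : 𝓢((Fin n → E4), ℂ)) (hF : IsOffDiagonal F) :
    Integrable (fun y : Fin n → E4 => ‖F y‖ * (C * (1 + ‖y‖) ^ N *
        (1 + ∑ i, ∑ j ∈ Finset.univ.erase i, ‖y i - y j‖⁻¹) ^ N)) ∧
      ‖T F‖ ≤ ∫ y : Fin n → E4, ‖F y‖ * (C * (1 + ‖y‖) ^ N *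
        (1 + ∑ i, ∑ j ∈ Finset.univ.erase i, ‖y i - y j‖⁻¹) ^ N) := by
  refine ⟨DegreeTwoModelBlind.integrable_norm_mul_pairWeight hC N hF, ?_⟩
  rw [rep_of_isOffDiagonal T K hC hKc hK hrep F hF]
  exact (norm_integral_le_integral_norm _).trans (integral_mono
    (integrable_kernel_mul K hC hKc hK hF).norm
    (DegreeTwoModelBlind.integrable_norm_mul_pairWeight hC N hF) fun y => norm_kernel_mul_le K hK hF y)

end DegreeThreeOfKernel

/-! ## The stub -/

/-- **Stub F `stub_degreeThreeOfKernel` (pure analysis + landed lemmas)** — registered signature of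
reshape 4 of the skeleton `Cruxes/TemperedCurvatureMoments/Lines/Sketch.lean`, verbatim.  A family
whose three-point function is, on compactly supported test functions supported in the injective
locus, integration against a kernel continuous there and dominated by T's weight
`C (1 + ‖y‖)^N (1 + Σᵢ Σ_{j ≠ i} ‖yᵢ - yⱼ‖⁻¹)^N`, and whose values on real off-diagonal tensors are
real, has tempered tied lattice approximants in degree 3 along every admissible `(a, L)`.  Route:
`DegreeThreeOfKernel.dominated_of_kernel` (extension of the representation to `⁰𝒮₃` by cut-offs at
infinity and at the diagonals, in the Schwartz topology, plus `‖𝔖₃ F‖ ≤ ∫ ‖F‖ w`) and the landed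
`temperedApproximants_of_dominated` with `n = 3`. [folklore] -/
theorem stub_degreeThreeOfKernel :
    ∀ (S₁ : SchwingerFamily E4), (∃ (K₃ : (Fin 3 → E4) → ℂ) (C : ℝ) (N : ℕ), 0 < C ∧ ContinuousOn K₃ {y | Function.Injective y} ∧
          (∀ y : Fin 3 → E4, Function.Injective y →
            ‖K₃ y‖ ≤ C * (1 + ‖y‖) ^ N * (1 + ∑ i, ∑ j ∈ Finset.univ.erase i, ‖y i - y j‖⁻¹) ^ N) ∧
          ∀ F : 𝓢((Fin 3 → E4), ℂ), HasCompactSupport (F : (Fin 3 → E4) → ℂ) →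
            tsupport (F : (Fin 3 → E4) → ℂ) ⊆ {y | Function.Injective y} →
              Integrable (fun y => K₃ y * F y) ∧ S₁ 3 F = ∫ y, K₃ y * F y) →
      (∀ (f : Fin 3 → 𝓢(E4, ℝ)) (F : 𝓢((Fin 3 → E4), ℂ)),
        IsTensorOf F (fun i => ofRealTest (f i)) → IsOffDiagonal F → (S₁ 3 F).im = 0) →
      ∀ (a : ℕ → ℝ) (L : ℕ → ℕ), (∀ k, 0 < a k) → Tendsto a atTop (𝓝 0) →
        Tendsto (fun k => a k * L k) atTop atTop → TemperedApproximants a L S₁ 3 := by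
  intro S₁ hK hreal a L ha ha0 haL
  obtain ⟨K₃, C, N, hC, hKc, hKb, hrep⟩ := hK
  exact temperedApproximants_of_dominated three_pos S₁ hC
    (fun F hF => DegreeThreeOfKernel.dominated_of_kernel (S₁ 3) K₃ hC hKc hKb hrep F hF)
    hreal ha ha0 haL

end Summit.QuantumFields.YangMills.Theorems.TemperedCurvatureMoments.Sketch

end
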